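import Summits.CriticalPhenomena.PercolationContinuityZ3.Theorems.PercNearOneGluingNoHeavyLowerTailSunflowerLeafLeafZTwo
import HarnessLib

/-!
# `NoHeavyLowerTail` (crux stmt-CriticalPhenomena-4575), abstract sunflower cubic: THE BASE CASE OF THE LEAF-LEAF LEMMA —
# petal systems whose petals ignore both leaves reduce to the twisted block inequality `BaseFour`

Support file (seat `prim-ineq-prove-1` gen 66; `--supports stmt-CriticalPhenomena-4575`).  No `sorry`, no named facts; one definition
(`BaseFour`, a parametrised `Prop`, conjecture-shaped) used only as a hypothesis.  Memo: run/shared/lean/prim/prim-ineq-prove-1/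
FINDING-RLA-prove1-g66.md §4.5.

SETTING (`…SunflowerLeafLeaf`, `…SunflowerLeafLeafZTwo`).  `A' = A ∪ {z₁,u open} ∪ ({z₁,z₂ open} ∪ {z₂,w open})` is the core of `Γ + z₁z₂`
for leaves `z₁ ~ u`, `z₂ ~ w` (`A` = the core of the rest, not depending on `z₁, z₂`).  The exchange-closed budget system of the memo (§4.3)
reduces the general leaf-leaf lemma to families made of BASE petals — petals `V` not depending on `z₁, z₂` — plus boundedly many special
petals.  A base petal has `V ∪ A' = Ê ∪ A'` with `E = V ∪ A`, and conditioning on `(z₁, z₂)` gives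
`μ(V ∪ A') = τt + τ(1−t)μ(E ∪ {u open}) + (1−τ)t·μ(E ∪ {w open}) + (1−τ)(1−t)μ(E)` (`τ = p_{z₁}`, `t = p_{z₂}`).  Conditioning `E` on
`(u, w)` (cells `e = μ(E|u,w closed)`, `g = μ(E|u closed, w open)`, `f = μ(E|u open, w closed)`, `h = μ(E|u,w open)`) turns this into the
LINEAR cell functional `μ(V ∪ A') ≤ F(e,g,f,h) := κ + w_e e + w_g g + w_f f + w_h h` with the TWISTED weights
`(w_e,w_g,w_f,w_h) = ((1−σ)(1−s)(1−τt), (1−σ)s(1−t), σ(1−s)(1−τ), σs(1−τ)(1−t))`, `κ = τt + τ(1−t)σ + (1−τ)ts` (product weights times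
`(1−τt, 1−t, 1−τ, (1−τ)(1−t))`: a log-submodular twist), with equality `F(α) = μ(A')` at the floors `α_ab = μ(A | u=a, w=b)`; the cell
sections of a petal system of `A` obey Lemma A for each of the nine faces of the block `(u,w)` (four cells, two rows, two columns, the
block), all safe when `A` is A-safe.  So THE BASE CASE OF THE LEAF-LEAF LEMMA IS A TWISTED LEMMA A ON A 2×2 BLOCK (`BaseFour`); memo §4.5
records why no smaller budget set can be used (the two-row projection "BaseTwo" is false at large coins already for `n = 2`; the
`e`-cell and the `w`-closed column are load-bearing) and the numerical support.
* `BaseFour σ s τ t α₀₀ α₀₁ α₁₀ α₁₁` — the twisted block inequality (statement; conjecture-shaped hypothesis);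
* **`leafLeaf_base_of_baseFour`** (fixed `p`) — `BaseFour` at `(p_u, p_w, p_{z₁}, p_{z₂}; α)` and safety at `p` of the nine minors/faces of
  `A` give Lemma A `∏ μ(V_i) ≤ μ(A')^(n−1)` for every family of up-sets not depending on `z₁, z₂` and meeting pairwise inside `A'`;
* `leafLeaf_base_of_baseFour_aSafe` — the same from A-safety of `A`.
-/

noncomputable section

namespace Summit.CriticalPhenomena.PercolationContinuityZ3.Theorems.SunflowerPartition

namespace SafeCalc

open MeasureTheory Finset
open Literature.Probability.LatticeModels Literature.Probability.Percolation

namespace LeafLeafZ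

/-- **`BaseFour` (statement): the twisted Lemma A on the `(u,w)`-block.**  Coins `σ = p_u`, `s = p_w`, `τ = p_{z₁}`, `t = p_{z₂}`;
floors `α_ab = μ(A | u = a, w = b)`; petals = cell quadruples `(e,g,f,h)` above the floors with the up-set links `e ≤ g ≤ h`, `e ≤ f ≤ h`,
`h ≤ 1`; budgets = Lemma A (product form) for the four cells, the two rows `(1−s)e+sg`, `(1−s)f+sh`, the two columns `(1−σ)e+σf`,
`(1−σ)g+σh` and the block `(1−σ)((1−s)e+sg) + σ((1−s)f+sh)`.  CLAIM: `∏ F(e_j,g_j,f_j,h_j) ≤ F(α)^(n−1)` for the twisted linear functional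
`F = κ + (1−σ)(1−s)(1−τt)e + (1−σ)s(1−t)g + σ(1−s)(1−τ)f + σs(1−τ)(1−t)h`, `κ = τt + τ(1−t)σ + (1−τ)ts`.  Open; numerically supported
(memo §4.5, §7); implies the base case of the leaf-leaf lemma (`leafLeaf_base_of_baseFour`). [conjecture-shaped hypothesis, this work] -/
def BaseFour (σ s τ t α00 α01 α10 α11 : ℝ) : Prop :=
  ∀ (n : ℕ) (e g f h : Fin n → ℝ),
    (∀ j, α00 ≤ e j) → (∀ j, α01 ≤ g j) → (∀ j, α10 ≤ f j) → (∀ j, α11 ≤ h j) → (∀ j, h j ≤ 1) →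
    (∀ j, e j ≤ g j) → (∀ j, e j ≤ f j) → (∀ j, g j ≤ h j) → (∀ j, f j ≤ h j) →
    ∏ j, e j ≤ α00 ^ (n - 1) → ∏ j, g j ≤ α01 ^ (n - 1) → ∏ j, f j ≤ α10 ^ (n - 1) → ∏ j, h j ≤ α11 ^ (n - 1) →
    ∏ j, ((1 - s) * e j + s * g j) ≤ ((1 - s) * α00 + s * α01) ^ (n - 1) →
    ∏ j, ((1 - s) * f j + s * h j) ≤ ((1 - s) * α10 + s * α11) ^ (n - 1) →
    ∏ j, ((1 - σ) * e j + σ * f j) ≤ ((1 - σ) * α00 + σ * α10) ^ (n - 1) →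
    ∏ j, ((1 - σ) * g j + σ * h j) ≤ ((1 - σ) * α01 + σ * α11) ^ (n - 1) →
    ∏ j, ((1 - σ) * ((1 - s) * e j + s * g j) + σ * ((1 - s) * f j + s * h j)) ≤
      ((1 - σ) * ((1 - s) * α00 + s * α01) + σ * ((1 - s) * α10 + s * α11)) ^ (n - 1) →
    ∏ j, (τ * t + τ * (1 - t) * σ + (1 - τ) * t * s + (1 - σ) * (1 - s) * (1 - τ * t) * e j + (1 - σ) * s * (1 - t) * g j +
        σ * (1 - s) * (1 - τ) * f j + σ * s * (1 - τ) * (1 - t) * h j) ≤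
      (τ * t + τ * (1 - t) * σ + (1 - τ) * t * s + (1 - σ) * (1 - s) * (1 - τ * t) * α00 + (1 - σ) * s * (1 - t) * α01 +
        σ * (1 - s) * (1 - τ) * α10 + σ * s * (1 - τ) * (1 - t) * α11) ^ (n - 1)

end LeafLeafZ

open RelLemmaA UnionEdge LeafLeafZ

variable {ι : Type*} [Fintype ι] [DecidableEq ι] (p : ι → unitInterval)

/-- **THE BASE CASE OF THE LEAF-LEAF LEMMA from `BaseFour` (fixed `p`).**  `A` an up-set not depending on `z₁, z₂`; `z₁, z₂, u, w`
pairwise distinct; the nine minors/faces of `A` over `(u,w)` safe at `p`; `BaseFour` at the coins `(p_u, p_w, p_{z₁}, p_{z₂})` and the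
floors of `A`.  Then every family of up-sets `V_i` NOT DEPENDING ON `z₁, z₂` and meeting pairwise inside
`A' = A ∪ {z₁,u open} ∪ ({z₁,z₂ open} ∪ {z₂,w open})` satisfies `∏ μ(V_i) ≤ μ(A')^(n−1)`. [this work] -/
theorem leafLeaf_base_of_baseFour {z₁ z₂ u w : ι} (h12 : z₁ ≠ z₂) (h1u : z₁ ≠ u) (h1w : z₁ ≠ w) (h2u : z₂ ≠ u) (h2w : z₂ ≠ w)
    (huw : u ≠ w) {A : Set (Set ι)} (hd₁ : DeterminedBy A (↑({z₁} : Finset ι) : Set ι)ᶜ)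
    (hd₂ : DeterminedBy A (↑({z₂} : Finset ι) : Set ι)ᶜ) (hA : IsUpperSet A)
    (hS00 : Safe p (secOff w (secOff u A))) (hS01 : Safe p (secOn w (secOff u A))) (hS10 : Safe p (secOff w (secOn u A)))
    (hS11 : Safe p (secOn w (secOn u A))) (hSu0 : Safe p (secOff u A)) (hSu1 : Safe p (secOn u A)) (hSw0 : Safe p (secOff w A))
    (hSw1 : Safe p (secOn w A)) (hAA : Safe p A)
    (hB : BaseFour (p u) (p w) (p z₁) (p z₂)
      ((prodBernoulli p).real (secOff w (secOff u A))) ((prodBernoulli p).real (secOn w (secOff u A)))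
      ((prodBernoulli p).real (secOff w (secOn u A))) ((prodBernoulli p).real (secOn w (secOn u A))))
    {n : ℕ} (V : Fin n → Set (Set ι)) (hV : ∀ i, IsUpperSet (V i))
    (hV₁ : ∀ i, DeterminedBy (V i) (↑({z₁} : Finset ι) : Set ι)ᶜ) (hV₂ : ∀ i, DeterminedBy (V i) (↑({z₂} : Finset ι) : Set ι)ᶜ)
    (hcap : ∀ i j, i ≠ j → V i ∩ V j ⊆ A ∪ pairOpen z₁ u ∪ (pairOpen z₁ z₂ ∪ pairOpen z₂ w)) :
    ∏ i, (prodBernoulli p).real (V i) ≤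
      (prodBernoulli p).real (A ∪ pairOpen z₁ u ∪ (pairOpen z₁ z₂ ∪ pairOpen z₂ w)) ^ (n - 1) := by
  classical
  rcases Nat.eq_zero_or_pos n with rfl | hn
  · simp
  set A' : Set (Set ι) := A ∪ pairOpen z₁ u ∪ (pairOpen z₁ z₂ ∪ pairOpen z₂ w) with hA'def
  have hA'up : IsUpperSet A' :=
    (hA.union (isUpperSet_pairOpen z₁ u)).union ((isUpperSet_pairOpen z₁ z₂).union (isUpperSet_pairOpen z₂ w))
  -- coins
  set τ : ℝ := ((p z₁ : unitInterval) : ℝ) with hτ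
  set t : ℝ := ((p z₂ : unitInterval) : ℝ) with ht
  set σ : ℝ := ((p u : unitInterval) : ℝ) with hσ
  set s : ℝ := ((p w : unitInterval) : ℝ) with hs
  have hτ0 : 0 ≤ τ := (p z₁).2.1
  have hτ1 : τ ≤ 1 := (p z₁).2.2
  have ht0 : 0 ≤ t := (p z₂).2.1
  have hσ0 : 0 ≤ σ := (p u).2.1
  have hσ1 : σ ≤ 1 := (p u).2.2
  have hs1 : s ≤ 1 := (p w).2.2
  -- floors
  set α00 : ℝ := (prodBernoulli p).real (secOff w (secOff u A)) with hα00
  set α01 : ℝ := (prodBernoulli p).real (secOn w (secOff u A)) with hα01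
  set α10 : ℝ := (prodBernoulli p).real (secOff w (secOn u A)) with hα10
  set α11 : ℝ := (prodBernoulli p).real (secOn w (secOn u A)) with hα11
  have hb0 : (prodBernoulli p).real (secOff u A) = (1 - s) * α00 + s * α01 := by
    rw [real_eq_secOn_secOff p w]; ring
  have hb1 : (prodBernoulli p).real (secOn u A) = (1 - s) * α10 + s * α11 := by
    rw [real_eq_secOn_secOff p w]; ring
  have hc0 : (prodBernoulli p).real (secOff w A) = (1 - σ) * α00 + σ * α10 := by
    rw [real_eq_secOn_secOff p u, secOn_secOff_comm huw, secOff_secOff_comm u w]; ring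
  have hc1 : (prodBernoulli p).real (secOn w A) = (1 - σ) * α01 + σ * α11 := by
    rw [real_eq_secOn_secOff p u, secOn_secOn_comm u w, ← secOn_secOff_comm huw.symm]; ring
  have hAval : (prodBernoulli p).real A = (1 - σ) * ((1 - s) * α00 + s * α01) + σ * ((1 - s) * α10 + s * α11) := by
    rw [real_eq_secOn_secOff p u A, hb0, hb1]; ring
  -- sections of `A` and `A'` at the leaves
  have hA_on₁ : secOn z₁ A = A := secOn_eq_self_of_determinedBy hd₁
  have hA_off₁ : secOff z₁ A = A := secOff_eq_self_of_determinedBy hd₁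
  have hA'_on : secOn z₂ A' = A ∪ pairOpen z₁ u ∪ ({ω | z₁ ∈ ω} ∪ {ω | w ∈ ω}) := by
    rw [hA'def, secOn_union, secOn_union, secOn_union, secOn_eq_self_of_determinedBy hd₂, secOn_pairOpen_of_ne h12 h2u.symm,
      secOn_pairOpen_right h12, secOn_pairOpen_left h2w]
  have hA'_off : secOff z₂ A' = A ∪ pairOpen z₁ u := by
    rw [hA'def, secOff_union, secOff_union, secOff_union, secOff_eq_self_of_determinedBy hd₂,
      secOff_pairOpen_of_ne h12 h2u.symm, secOff_pairOpen_right, secOff_pairOpen_left, Set.union_empty, Set.union_empty]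
  have hA'_10 : secOn z₁ (secOff z₂ A') = A ∪ {ω | u ∈ ω} := by
    rw [hA'_off, secOn_union, hA_on₁, secOn_pairOpen_left h1u]
  have hA'_01 : secOff z₁ (secOn z₂ A') = A ∪ {ω | w ∈ ω} := by
    rw [hA'_on, secOff_union, secOff_union, secOff_union, hA_off₁, secOff_pairOpen_left, secOff_setOf_mem_self,
      secOff_setOf_mem_of_ne h1w.symm, Set.union_empty, Set.empty_union]
  have hA'_00 : secOff z₁ (secOff z₂ A') = A := by
    rw [hA'_off, secOff_union, hA_off₁, secOff_pairOpen_left, Set.union_empty]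
  -- enlarge the petals; `E_i := V_i ∪ A`
  set W : Fin n → Set (Set ι) := fun i => V i ∪ A' with hW
  set E : Fin n → Set (Set ι) := fun i => V i ∪ A with hE
  have hWup : ∀ i, IsUpperSet (W i) := fun i => (hV i).union hA'up
  have hEup : ∀ i, IsUpperSet (E i) := fun i => (hV i).union hA
  have hEA : ∀ i, A ⊆ E i := fun i => Set.subset_union_right
  have hmono : ∀ i, (prodBernoulli p).real (V i) ≤ (prodBernoulli p).real (W i) :=
    fun i => measureReal_mono Set.subset_union_left
  have hVon₁ : ∀ i, secOn z₁ (V i) = V i := fun i => secOn_eq_self_of_determinedBy (hV₁ i)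
  have hVoff₁ : ∀ i, secOff z₁ (V i) = V i := fun i => secOff_eq_self_of_determinedBy (hV₁ i)
  have hVon₂ : ∀ i, secOn z₂ (V i) = V i := fun i => secOn_eq_self_of_determinedBy (hV₂ i)
  have hVoff₂ : ∀ i, secOff z₂ (V i) = V i := fun i => secOff_eq_self_of_determinedBy (hV₂ i)
  have hW10 : ∀ i, secOn z₁ (secOff z₂ (W i)) = E i ∪ {ω | u ∈ ω} := by
    intro i; simp only [hW, hE]; rw [secOff_union, secOn_union, hVoff₂, hVon₁, hA'_10, Set.union_assoc]
  have hW01 : ∀ i, secOff z₁ (secOn z₂ (W i)) = E i ∪ {ω | w ∈ ω} := by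
    intro i; simp only [hW, hE]; rw [secOn_union, secOff_union, hVon₂, hVoff₁, hA'_01, Set.union_assoc]
  have hW00 : ∀ i, secOff z₁ (secOff z₂ (W i)) = E i := by
    intro i; simp only [hW, hE]; rw [secOff_union, secOff_union, hVoff₂, hVoff₁, hA'_00]
  have hEcap : ∀ i j, i ≠ j → E i ∩ E j ⊆ A := by
    intro i j hij
    have h1 : W i ∩ W j ⊆ A' := by
      intro ω hω
      rcases hω with ⟨h1 | h1, h2 | h2⟩
      · exact hcap i j hij ⟨h1, h2⟩
      exacts [h2, h1, h1]
    have h2 := secOff_mono z₁ (secOff_mono z₂ h1)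
    rw [secOff_inter, secOff_inter, hW00, hW00, hA'_00] at h2
    exact h2
  -- cell data of petal `i`
  set ce : Fin n → ℝ := fun i => (prodBernoulli p).real (secOff w (secOff u (E i))) with hce
  set cg : Fin n → ℝ := fun i => (prodBernoulli p).real (secOn w (secOff u (E i))) with hcg
  set cf : Fin n → ℝ := fun i => (prodBernoulli p).real (secOff w (secOn u (E i))) with hcf
  set ch : Fin n → ℝ := fun i => (prodBernoulli p).real (secOn w (secOn u (E i))) with hch
  have fe : ∀ i, α00 ≤ ce i := fun i => measureReal_mono (secOff_mono w (secOff_mono u (hEA i)))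
  have fg : ∀ i, α01 ≤ cg i := fun i => measureReal_mono (secOn_mono w (secOff_mono u (hEA i)))
  have ff : ∀ i, α10 ≤ cf i := fun i => measureReal_mono (secOff_mono w (secOn_mono u (hEA i)))
  have fh : ∀ i, α11 ≤ ch i := fun i => measureReal_mono (secOn_mono w (secOn_mono u (hEA i)))
  have ch1 : ∀ i, ch i ≤ 1 := fun i => measureReal_le_one
  have leg : ∀ i, ce i ≤ cg i := fun i => measureReal_mono (secOff_subset_secOn w (isUpperSet_secOff u (hEup i)))
  have lef : ∀ i, ce i ≤ cf i := fun i => by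
    simp only [hce, hcf]; rw [secOff_secOff_comm w u, ← secOn_secOff_comm huw]
    exact measureReal_mono (secOff_subset_secOn u (isUpperSet_secOff w (hEup i)))
  have lgh : ∀ i, cg i ≤ ch i := fun i => by
    simp only [hcg, hch]; rw [secOn_secOff_comm huw.symm, secOn_secOn_comm w u]
    exact measureReal_mono (secOff_subset_secOn u (isUpperSet_secOn w (hEup i)))
  have lfh : ∀ i, cf i ≤ ch i := fun i => measureReal_mono (secOff_subset_secOn w (isUpperSet_secOn u (hEup i)))
  -- row / column / block values
  have hrow0 : ∀ i, (prodBernoulli p).real (secOff u (E i)) = (1 - s) * ce i + s * cg i := fun i => by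
    rw [real_eq_secOn_secOff p w]; ring
  have hrow1 : ∀ i, (prodBernoulli p).real (secOn u (E i)) = (1 - s) * cf i + s * ch i := fun i => by
    rw [real_eq_secOn_secOff p w]; ring
  have hcol0 : ∀ i, (prodBernoulli p).real (secOff w (E i)) = (1 - σ) * ce i + σ * cf i := fun i => by
    rw [real_eq_secOn_secOff p u, secOn_secOff_comm huw, secOff_secOff_comm u w]; ring
  have hcol1 : ∀ i, (prodBernoulli p).real (secOn w (E i)) = (1 - σ) * cg i + σ * ch i := fun i => by
    rw [real_eq_secOn_secOff p u, secOn_secOn_comm u w, ← secOn_secOff_comm huw.symm]; ring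
  have hblk : ∀ i, (prodBernoulli p).real (E i) = (1 - σ) * ((1 - s) * ce i + s * cg i) + σ * ((1 - s) * cf i + s * ch i) :=
    fun i => by rw [real_eq_secOn_secOff p u, hrow0, hrow1]; ring
  -- the nine budgets
  have cap2 : ∀ (op₁ op₂ : Set (Set ι) → Set (Set ι)), (∀ X Y, op₁ (X ∩ Y) = op₁ X ∩ op₁ Y) → (∀ X Y, op₂ (X ∩ Y) = op₂ X ∩ op₂ Y) →
      (∀ X Y, X ⊆ Y → op₁ X ⊆ op₁ Y) → (∀ X Y, X ⊆ Y → op₂ X ⊆ op₂ Y) →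
      ∀ i j, i ≠ j → op₁ (op₂ (E i)) ∩ op₁ (op₂ (E j)) ⊆ op₁ (op₂ A) := by
    intro op₁ op₂ h₁ h₂ m₁ m₂ i j hij
    rw [← h₁, ← h₂]; exact m₁ _ _ (m₂ _ _ (hEcap i j hij))
  have cap1 : ∀ (op : Set (Set ι) → Set (Set ι)), (∀ X Y, op (X ∩ Y) = op X ∩ op Y) → (∀ X Y, X ⊆ Y → op X ⊆ op Y) →
      ∀ i j, i ≠ j → op (E i) ∩ op (E j) ⊆ op A := by
    intro op h₁ m₁ i j hij
    rw [← h₁]; exact m₁ _ _ (hEcap i j hij)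
  have Be : ∏ i, ce i ≤ α00 ^ (n - 1) :=
    hS00 n _ (fun i => isUpperSet_secOff w (isUpperSet_secOff u (hEup i)))
      (cap2 (secOff w) (secOff u) (secOff_inter w) (secOff_inter u) (fun _ _ => secOff_mono w) (fun _ _ => secOff_mono u))
  have Bg : ∏ i, cg i ≤ α01 ^ (n - 1) :=
    hS01 n _ (fun i => isUpperSet_secOn w (isUpperSet_secOff u (hEup i)))
      (cap2 (secOn w) (secOff u) (secOn_inter w) (secOff_inter u) (fun _ _ => secOn_mono w) (fun _ _ => secOff_mono u))
  have Bf : ∏ i, cf i ≤ α10 ^ (n - 1) :=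
    hS10 n _ (fun i => isUpperSet_secOff w (isUpperSet_secOn u (hEup i)))
      (cap2 (secOff w) (secOn u) (secOff_inter w) (secOn_inter u) (fun _ _ => secOff_mono w) (fun _ _ => secOn_mono u))
  have Bh : ∏ i, ch i ≤ α11 ^ (n - 1) :=
    hS11 n _ (fun i => isUpperSet_secOn w (isUpperSet_secOn u (hEup i)))
      (cap2 (secOn w) (secOn u) (secOn_inter w) (secOn_inter u) (fun _ _ => secOn_mono w) (fun _ _ => secOn_mono u))
  have Br0 : ∏ i, ((1 - s) * ce i + s * cg i) ≤ ((1 - s) * α00 + s * α01) ^ (n - 1) := by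
    rw [← hb0]
    refine le_of_eq_of_le (prod_congr rfl fun i _ => (hrow0 i).symm) ?_
    exact hSu0 n _ (fun i => isUpperSet_secOff u (hEup i)) (cap1 (secOff u) (secOff_inter u) (fun _ _ => secOff_mono u))
  have Br1 : ∏ i, ((1 - s) * cf i + s * ch i) ≤ ((1 - s) * α10 + s * α11) ^ (n - 1) := by
    rw [← hb1]
    refine le_of_eq_of_le (prod_congr rfl fun i _ => (hrow1 i).symm) ?_
    exact hSu1 n _ (fun i => isUpperSet_secOn u (hEup i)) (cap1 (secOn u) (secOn_inter u) (fun _ _ => secOn_mono u))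
  have Bc0 : ∏ i, ((1 - σ) * ce i + σ * cf i) ≤ ((1 - σ) * α00 + σ * α10) ^ (n - 1) := by
    rw [← hc0]
    refine le_of_eq_of_le (prod_congr rfl fun i _ => (hcol0 i).symm) ?_
    exact hSw0 n _ (fun i => isUpperSet_secOff w (hEup i)) (cap1 (secOff w) (secOff_inter w) (fun _ _ => secOff_mono w))
  have Bc1 : ∏ i, ((1 - σ) * cg i + σ * ch i) ≤ ((1 - σ) * α01 + σ * α11) ^ (n - 1) := by
    rw [← hc1]
    refine le_of_eq_of_le (prod_congr rfl fun i _ => (hcol1 i).symm) ?_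
    exact hSw1 n _ (fun i => isUpperSet_secOn w (hEup i)) (cap1 (secOn w) (secOn_inter w) (fun _ _ => secOn_mono w))
  have BA : ∏ i, ((1 - σ) * ((1 - s) * ce i + s * cg i) + σ * ((1 - s) * cf i + s * ch i)) ≤
      ((1 - σ) * ((1 - s) * α00 + s * α01) + σ * ((1 - s) * α10 + s * α11)) ^ (n - 1) := by
    rw [← hAval]
    refine le_of_eq_of_le (prod_congr rfl fun i _ => (hblk i).symm) ?_
    exact hAA n E hEup hEcap
  -- the cellwise value of a base petal
  have hval : ∀ i, (prodBernoulli p).real (W i) ≤ τ * t + τ * (1 - t) * σ + (1 - τ) * t * s +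
      (1 - σ) * (1 - s) * (1 - τ * t) * ce i + (1 - σ) * s * (1 - t) * cg i + σ * (1 - s) * (1 - τ) * cf i +
      σ * s * (1 - τ) * (1 - t) * ch i := by
    intro i
    have e11 : (prodBernoulli p).real (secOn z₁ (secOn z₂ (W i))) ≤ 1 := measureReal_le_one
    have e10 : (prodBernoulli p).real (secOn z₁ (secOff z₂ (W i))) = σ + (1 - σ) * ((1 - s) * ce i + s * cg i) := by
      rw [hW10, real_eq_secOn_secOff p u, secOn_union, secOn_setOf_mem_self, Set.union_univ, secOff_union, secOff_setOf_mem_self,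
        Set.union_empty, probReal_univ, hrow0]
      ring
    have e01 : (prodBernoulli p).real (secOff z₁ (secOn z₂ (W i))) = s + (1 - s) * ((1 - σ) * ce i + σ * cf i) := by
      rw [hW01, real_eq_secOn_secOff p w, secOn_union, secOn_setOf_mem_self, Set.union_univ, secOff_union, secOff_setOf_mem_self,
        Set.union_empty, probReal_univ, hcol0]
      ring
    have e00 : (prodBernoulli p).real (secOff z₁ (secOff z₂ (W i))) =
        (1 - σ) * ((1 - s) * ce i + s * cg i) + σ * ((1 - s) * cf i + s * ch i) := by rw [hW00, hblk]
    rw [real_eq_secOn_secOff p z₂ (W i), real_eq_secOn_secOff p z₁ (secOn z₂ (W i)),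
      real_eq_secOn_secOff p z₁ (secOff z₂ (W i)), e10, e01, e00]
    have k3 : t * (τ * (prodBernoulli p).real (secOn z₁ (secOn z₂ (W i)))) ≤ t * (τ * 1) :=
      mul_le_mul_of_nonneg_left (mul_le_mul_of_nonneg_left e11 hτ0) ht0
    linarith only [k3]
  -- the value of the core
  have hA'val : (prodBernoulli p).real A' = τ * t + τ * (1 - t) * σ + (1 - τ) * t * s +
      (1 - σ) * (1 - s) * (1 - τ * t) * α00 + (1 - σ) * s * (1 - t) * α01 + σ * (1 - s) * (1 - τ) * α10 +
      σ * s * (1 - τ) * (1 - t) * α11 := by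
    have e10 : (prodBernoulli p).real (secOn z₁ (secOff z₂ A')) = σ + (1 - σ) * ((1 - s) * α00 + s * α01) := by
      rw [hA'_10, real_eq_secOn_secOff p u, secOn_union, secOn_setOf_mem_self, Set.union_univ, secOff_union, secOff_setOf_mem_self,
        Set.union_empty, probReal_univ, hb0]
      ring
    have e01 : (prodBernoulli p).real (secOff z₁ (secOn z₂ A')) = s + (1 - s) * ((1 - σ) * α00 + σ * α10) := by
      rw [hA'_01, real_eq_secOn_secOff p w, secOn_union, secOn_setOf_mem_self, Set.union_univ, secOff_union, secOff_setOf_mem_self,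
        Set.union_empty, probReal_univ, hc0]
      ring
    have e11 : (prodBernoulli p).real (secOn z₁ (secOn z₂ A')) = 1 := by
      have h1 : secOn z₁ (secOn z₂ A') = Set.univ := by
        rw [hA'_on, secOn_union, secOn_union, secOn_union, secOn_setOf_mem_self]; simp
      rw [h1, probReal_univ]
    rw [real_eq_secOn_secOff p z₂ A', real_eq_secOn_secOff p z₁ (secOn z₂ A'), real_eq_secOn_secOff p z₁ (secOff z₂ A'),
      e11, e10, e01, hA'_00, hAval]
    ring
  -- assemble
  have key := hB n ce cg cf ch fe fg ff fh ch1 leg lef lgh lfh Be Bg Bf Bh Br0 Br1 Bc0 Bc1 BA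
  rw [hA'val]
  calc ∏ i, (prodBernoulli p).real (V i) ≤ ∏ i, (prodBernoulli p).real (W i) :=
        prod_le_prod (fun i _ => measureReal_nonneg) fun i _ => hmono i
    _ ≤ _ := (prod_le_prod (fun i _ => measureReal_nonneg) fun i _ => hval i).trans key

/-- **The base case of the leaf-leaf lemma from `BaseFour` and A-safety of `A`** (the nine minors of an A-safe core are safe at every
`p`: `aSafe_delMinor`, `aSafe_conMinor`). [this work] -/
theorem leafLeaf_base_of_baseFour_aSafe {z₁ z₂ u w : ι} (h12 : z₁ ≠ z₂) (h1u : z₁ ≠ u) (h1w : z₁ ≠ w) (h2u : z₂ ≠ u)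
    (h2w : z₂ ≠ w) (huw : u ≠ w) {A : Set (Set ι)} (hd₁ : DeterminedBy A (↑({z₁} : Finset ι) : Set ι)ᶜ)
    (hd₂ : DeterminedBy A (↑({z₂} : Finset ι) : Set ι)ᶜ) (hA : IsUpperSet A) (hsafe : ∀ q, Safe q A)
    (hB : BaseFour (p u) (p w) (p z₁) (p z₂)
      ((prodBernoulli p).real (secOff w (secOff u A))) ((prodBernoulli p).real (secOn w (secOff u A)))
      ((prodBernoulli p).real (secOff w (secOn u A))) ((prodBernoulli p).real (secOn w (secOn u A))))
    {n : ℕ} (V : Fin n → Set (Set ι)) (hV : ∀ i, IsUpperSet (V i))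
    (hV₁ : ∀ i, DeterminedBy (V i) (↑({z₁} : Finset ι) : Set ι)ᶜ) (hV₂ : ∀ i, DeterminedBy (V i) (↑({z₂} : Finset ι) : Set ι)ᶜ)
    (hcap : ∀ i j, i ≠ j → V i ∩ V j ⊆ A ∪ pairOpen z₁ u ∪ (pairOpen z₁ z₂ ∪ pairOpen z₂ w)) :
    ∏ i, (prodBernoulli p).real (V i) ≤
      (prodBernoulli p).real (A ∪ pairOpen z₁ u ∪ (pairOpen z₁ z₂ ∪ pairOpen z₂ w)) ^ (n - 1) := by
  have hu0 : IsUpperSet (secOff u A) := isUpperSet_secOff u hA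
  have hu1 : IsUpperSet (secOn u A) := isUpperSet_secOn u hA
  have au0 : ∀ q, Safe q (secOff u A) := fun q => aSafe_delMinor hA hsafe u q
  have au1 : ∀ q, Safe q (secOn u A) := fun q => aSafe_conMinor hA hsafe u q
  exact leafLeaf_base_of_baseFour p h12 h1u h1w h2u h2w huw hd₁ hd₂ hA (aSafe_delMinor hu0 au0 w p) (aSafe_conMinor hu0 au0 w p)
    (aSafe_delMinor hu1 au1 w p) (aSafe_conMinor hu1 au1 w p) (au0 p) (au1 p) (aSafe_delMinor hA hsafe w p)
    (aSafe_conMinor hA hsafe w p) (hsafe p) hB V hV hV₁ hV₂ hcap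

end SafeCalc

end Summit.CriticalPhenomena.PercolationContinuityZ3.Theorems.SunflowerPartition
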